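import Mathlib.NumberTheory.LSeries.PrimesInAP
import Mathlib.NumberTheory.Chebyshev
import Literature.NumberTheory.LFunctions.WienerIkeharaProofs
import HarnessLib

/-!
# The prime number theorem for arithmetic progressions (qualitative form, fixed modulus)

Topic `Literature/NumberTheory/LFunctions`. For a fixed modulus `q ≥ 1` and a reduced residue
`a (mod q)`,

  `ψ(x; q, a) = ∑_{n ≤ x, n ≡ a (q)} Λ(n) = x/φ(q) + o_q(x)`   (de la Vallée Poussin, 1896),

the main term of Montgomery–Vaughan 2007, Cor. 11.17, in qualitative form; together with the
`θ`-form `θ(x; q, a) = ∑_{p ≤ x, p ≡ a (q)} log p = x/φ(q) + o_q(x)` (prime powers contribute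
`ψ(x) - θ(x) = O(√x)`, Montgomery–Vaughan §4.3.1 Exercise 5(a); Mathlib
`Chebyshev.psi_sub_theta_le_mul_sqrt`) and the case `q = 1`, the prime number theorem
`ψ(x) = x + o(x)`, `θ(x) = x + o(x)`.

Everything here is PROVED (no named facts): the Wiener–Ikehara Tauberian theorem
(Montgomery–Vaughan Cor. 8.8) is the tree's `Literature.NumberTheory.LFunctions.WienerIkehara_holds`
(`Literature.NumberTheory.LFunctions.WienerIkeharaProofs`), and its hypothesis — the Dirichlet
series `∑_{n ≡ a (q)} Λ(n) n^{-s}` is `φ(q)⁻¹/(s-1)` plus a function continuous on `Re s ≥ 1` — is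
Mathlib's packaging of the non-vanishing of Dirichlet `L`-functions on `Re s = 1`
(`ArithmeticFunction.vonMangoldt.LFunctionResidueClassAux`,
`ArithmeticFunction.vonMangoldt.continuousOn_LFunctionResidueClassAux`,
`ArithmeticFunction.vonMangoldt.eqOn_LFunctionResidueClassAux`, the ingredients of Mathlib's proof
of Dirichlet's theorem in `Mathlib.NumberTheory.LSeries.PrimesInAP`).

All statements are along the integers `X → ∞` (`ψ(x; q, a)` only depends on `⌊x⌋`), in
little-`o` form, with `ψ(X; q, a) = ∑_{n ∈ [1, X]} Λ|_{a mod q}(n)` written with Mathlib's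
`ArithmeticFunction.vonMangoldt.residueClass a`.

## Main results

* `Literature.NumberTheory.LFunctions.vonMangoldt_residueClass_sum_isLittleO` : `ψ(X; q, a) - X/φ(q) = o(X)`.
* `Literature.NumberTheory.LFunctions.psi_sub_theta_natCast_isLittleO` : `ψ(X) - θ(X) = o(X)`.
* `Literature.NumberTheory.LFunctions.sum_log_prime_residue_isLittleO` : `θ(X; q, a) - X/φ(q) = o(X)`.
* `Literature.NumberTheory.LFunctions.chebyshevPsi_sub_self_isLittleO`, `Literature.NumberTheory.LFunctions.chebyshevTheta_sub_self_isLittleO` : the prime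
  number theorem `ψ(X) - X = o(X)`, `θ(X) - X = o(X)` (the case `q = 1`).

## References

* H. L. Montgomery, R. C. Vaughan, *Multiplicative Number Theory I. Classical Theory*,
  Cambridge Stud. Adv. Math. 97, CUP 2007: Cor. 8.8 (Wiener–Ikehara), Cor. 11.17 (Page; its main
  term `x/φ(q)` is the statement proved here qualitatively), §4.3.1 Exercise 5(a)
  (`θ(x; q, a) = ψ(x; q, a) + O(x^{1/2})`). [cite: MontgomeryVaughan2007]
-/

noncomputable section

open Filter Asymptotics Finset

namespace Literature.NumberTheory.LFunctions

/-- **Prime number theorem for arithmetic progressions, fixed modulus, `ψ`-form**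
(de la Vallée Poussin; the main term of Montgomery–Vaughan 2007 Cor. 11.17): for `q ≥ 1` and a
unit `a ∈ ℤ/qℤ`, `∑_{1 ≤ n ≤ X, n ≡ a (q)} Λ(n) - X/φ(q) = o(X)` as `X → ∞` through the
integers. Proof: Wiener–Ikehara (`Literature.NumberTheory.LFunctions.WienerIkehara_holds`, MV Cor. 8.8) applied to
`a_n = Λ|_{a mod q}(n) ≥ 0`, whose Dirichlet series minus `φ(q)⁻¹/(s-1)` extends continuously to
`Re s ≥ 1` (Mathlib's `ArithmeticFunction.vonMangoldt.LFunctionResidueClassAux`).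
[cite: MontgomeryVaughan2007, Cor. 11.17 (main term) and Cor. 8.8] -/
theorem vonMangoldt_residueClass_sum_isLittleO {q : ℕ} [NeZero q] {a : ZMod q} (ha : IsUnit a) :
    (fun X : ℕ => ∑ n ∈ Icc 1 X, ArithmeticFunction.vonMangoldt.residueClass a n -
        (q.totient : ℝ)⁻¹ * X) =o[atTop] fun X : ℕ => (X : ℝ) := by
  refine WienerIkehara_holds _ _ (ArithmeticFunction.vonMangoldt.residueClass_nonneg a) ?_ ?_
  · intro s hs
    exact LSeriesSummable_of_abscissaOfAbsConv_lt_re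
      ((ArithmeticFunction.vonMangoldt.abscissaOfAbsConv_residueClass_le_one a).trans_lt
        (by exact_mod_cast hs))
  · refine ⟨ArithmeticFunction.vonMangoldt.LFunctionResidueClassAux a,
      ArithmeticFunction.vonMangoldt.continuousOn_LFunctionResidueClassAux a, fun s hs => ?_⟩
    rw [ArithmeticFunction.vonMangoldt.eqOn_LFunctionResidueClassAux ha hs]
    push_cast
    rfl

/-- `ψ(X) - θ(X) = o(X)` along the integers (indeed `O(√X)`, Mathlib
`Chebyshev.psi_sub_theta_le_mul_sqrt`; Montgomery–Vaughan Thm. 2.7 region / §4.3.1 Ex. 5(a)).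
[cite: MontgomeryVaughan2007, §4.3.1 Exercise 5(a)] -/
theorem psi_sub_theta_natCast_isLittleO :
    (fun X : ℕ => Chebyshev.psi X - Chebyshev.theta X) =o[atTop] fun X : ℕ => (X : ℝ) := by
  obtain ⟨C₀, hC₀⟩ := Chebyshev.psi_sub_theta_le_mul_sqrt
  set C : ℝ := max C₀ 1 with hC_def
  have hC0 : 0 < C := lt_max_of_lt_right one_pos
  have hC : ∀ x, Chebyshev.psi x - Chebyshev.theta x ≤ C * Real.sqrt x := fun x =>
    (hC₀ x).trans (mul_le_mul_of_nonneg_right (le_max_left _ _) (Real.sqrt_nonneg _))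
  rw [Asymptotics.isLittleO_iff]
  intro c hc
  filter_upwards [eventually_ge_atTop ⌈(C / c) ^ 2⌉₊] with X hX
  have hX' : (C / c) ^ 2 ≤ (X : ℝ) := (Nat.ceil_le).1 hX
  have h0 : 0 ≤ Chebyshev.psi X - Chebyshev.theta X := sub_nonneg.2 (Chebyshev.theta_le_psi _)
  rw [Real.norm_of_nonneg h0, Real.norm_of_nonneg (Nat.cast_nonneg _)]
  have hsqrt : C / c ≤ Real.sqrt X := by
    rw [show C / c = Real.sqrt ((C / c) ^ 2) from (Real.sqrt_sq (by positivity)).symm]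
    exact Real.sqrt_le_sqrt hX'
  calc Chebyshev.psi X - Chebyshev.theta X ≤ C * Real.sqrt X := hC X
    _ = (C / c) * (c * Real.sqrt X) := by field_simp
    _ ≤ Real.sqrt X * (c * Real.sqrt X) := by gcongr
    _ = c * X := by rw [mul_left_comm, Real.mul_self_sqrt (Nat.cast_nonneg _)]

/-- `θ(X; q, a) ≤ ψ(X; q, a) ≤ θ(X; q, a) + (ψ(X) - θ(X))`: in a residue class the prime powers
`p^k`, `k ≥ 2`, contribute at most what they contribute in total (Montgomery–Vaughan §4.3.1
Exercise 5(a)). Here `θ(X; q, a) = ∑_{1 ≤ p ≤ X, p prime, p ≡ a (q)} log p` and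
`ψ(X; q, a) = ∑_{1 ≤ n ≤ X} Λ|_{a mod q}(n)`. [cite: MontgomeryVaughan2007, §4.3.1 Exercise 5(a)] -/
theorem sum_log_prime_residue_le_and_le {q : ℕ} (a : ZMod q) (X : ℕ) :
    ∑ m ∈ Icc 1 X, ArithmeticFunction.vonMangoldt.residueClass a m -
        (Chebyshev.psi X - Chebyshev.theta X) ≤
      ∑ p ∈ Icc 1 X with p.Prime ∧ ((p : ℕ) : ZMod q) = a, Real.log p ∧
    ∑ p ∈ Icc 1 X with p.Prime ∧ ((p : ℕ) : ZMod q) = a, Real.log p ≤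
      ∑ m ∈ Icc 1 X, ArithmeticFunction.vonMangoldt.residueClass a m := by
  have hI : Finset.Icc 1 X = Finset.Ioc 0 X := Finset.Icc_add_one_left_eq_Ioc 0 X
  have hres : ∑ m ∈ Icc 1 X, ArithmeticFunction.vonMangoldt.residueClass a m =
      ∑ m ∈ Icc 1 X, if ((m : ℕ) : ZMod q) = a then ArithmeticFunction.vonMangoldt m else 0 := by
    refine Finset.sum_congr rfl fun m _ => ?_
    simp only [ArithmeticFunction.vonMangoldt.residueClass, Set.indicator_apply, Set.mem_setOf_eq]
  have hth : ∑ p ∈ Icc 1 X with p.Prime ∧ ((p : ℕ) : ZMod q) = a, Real.log p =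
      ∑ m ∈ Icc 1 X, if ((m : ℕ) : ZMod q) = a then (if m.Prime then Real.log m else 0) else 0 := by
    rw [Finset.sum_filter]
    refine Finset.sum_congr rfl fun m _ => ?_
    by_cases h1 : m.Prime <;> by_cases h2 : ((m : ℕ) : ZMod q) = a <;> simp [h1, h2]
  have hpsi : Chebyshev.psi X = ∑ m ∈ Icc 1 X, ArithmeticFunction.vonMangoldt m := by
    rw [Chebyshev.psi, Nat.floor_natCast, ← hI]
  have htheta : Chebyshev.theta X = ∑ m ∈ Icc 1 X, if m.Prime then Real.log m else 0 := by
    rw [Chebyshev.theta, Nat.floor_natCast, ← hI, Finset.sum_filter]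
  have hpt : ∀ m : ℕ, (0 : ℝ) ≤ (if m.Prime then Real.log m else 0) ∧
      (if m.Prime then Real.log m else 0) ≤ ArithmeticFunction.vonMangoldt m := by
    intro m
    split_ifs with hm
    · rw [ArithmeticFunction.vonMangoldt_apply_prime hm]
      exact ⟨Real.log_natCast_nonneg m, le_rfl⟩
    · exact ⟨le_rfl, ArithmeticFunction.vonMangoldt_nonneg⟩
  constructor
  · rw [hres, hth, hpsi, htheta, ← Finset.sum_sub_distrib, sub_le_iff_le_add,
      ← Finset.sum_add_distrib]
    refine Finset.sum_le_sum fun m _ => ?_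
    have := hpt m
    split_ifs at this ⊢ <;> linarith [this.1, this.2]
  · rw [hres, hth]
    refine Finset.sum_le_sum fun m _ => ?_
    have := hpt m
    split_ifs at this ⊢ <;> linarith [this.1, this.2]

/-- **Prime number theorem for arithmetic progressions, fixed modulus, `θ`-form**: for `q ≥ 1`
and a unit `a ∈ ℤ/qℤ`, `∑_{p ≤ X, p prime, p ≡ a (q)} log p - X/φ(q) = o(X)`.
[cite: MontgomeryVaughan2007, Cor. 11.17 (main term) with §4.3.1 Exercise 5(a)] -/
theorem sum_log_prime_residue_isLittleO {q : ℕ} [NeZero q] {a : ZMod q} (ha : IsUnit a) :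
    (fun X : ℕ => ∑ p ∈ Icc 1 X with p.Prime ∧ ((p : ℕ) : ZMod q) = a, Real.log p -
        (q.totient : ℝ)⁻¹ * X) =o[atTop] fun X : ℕ => (X : ℝ) := by
  have hA := vonMangoldt_residueClass_sum_isLittleO ha
  have hD : (fun X : ℕ => ∑ m ∈ Icc 1 X, ArithmeticFunction.vonMangoldt.residueClass a m -
      ∑ p ∈ Icc 1 X with p.Prime ∧ ((p : ℕ) : ZMod q) = a, Real.log p) =O[atTop]
      fun X : ℕ => Chebyshev.psi X - Chebyshev.theta X := by
    refine IsBigO.of_bound 1 (Eventually.of_forall fun X => ?_)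
    have h := sum_log_prime_residue_le_and_le a X
    have h0 : 0 ≤ Chebyshev.psi X - Chebyshev.theta X := sub_nonneg.2 (Chebyshev.theta_le_psi _)
    rw [one_mul, Real.norm_of_nonneg h0, Real.norm_of_nonneg (sub_nonneg.2 h.2)]
    linarith [h.1]
  refine (hA.sub (hD.trans_isLittleO psi_sub_theta_natCast_isLittleO)).congr' ?_ EventuallyEq.rfl
  exact Eventually.of_forall fun X => by ring

/-- **The prime number theorem**, `ψ(X) - X = o(X)` along the integers (the case `q = 1`:
every `n` lies in the unique residue class mod `1`). (Hadamard, de la Vallée Poussin 1896;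
Montgomery–Vaughan Thm. 6.9 main term / §8.3.) [cite: MontgomeryVaughan2007, Thm. 6.9 (main term) and Cor. 8.8] -/
theorem chebyshevPsi_sub_self_isLittleO :
    (fun X : ℕ => Chebyshev.psi X - X) =o[atTop] fun X : ℕ => (X : ℝ) := by
  have h := vonMangoldt_residueClass_sum_isLittleO (isUnit_of_subsingleton (0 : ZMod 1))
  refine h.congr' (Eventually.of_forall fun X => ?_) EventuallyEq.rfl
  have hI : Finset.Icc 1 X = Finset.Ioc 0 X := Finset.Icc_add_one_left_eq_Ioc 0 X
  simp only [Nat.totient_one, Nat.cast_one, inv_one, one_mul, Chebyshev.psi, Nat.floor_natCast,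
    ← hI]
  congr 1
  refine Finset.sum_congr rfl fun m _ => ?_
  simp [ArithmeticFunction.vonMangoldt.residueClass, Subsingleton.elim _ (0 : ZMod 1)]

/-- **The prime number theorem, `θ`-form**: `θ(X) - X = o(X)` along the integers.
[cite: MontgomeryVaughan2007, Thm. 6.9 (main term) and Cor. 8.8] -/
theorem chebyshevTheta_sub_self_isLittleO :
    (fun X : ℕ => Chebyshev.theta X - X) =o[atTop] fun X : ℕ => (X : ℝ) := by
  refine (chebyshevPsi_sub_self_isLittleO.sub psi_sub_theta_natCast_isLittleO).congr'
    (Eventually.of_forall fun X => ?_) EventuallyEq.rfl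
  ring

end Literature.NumberTheory.LFunctions

end
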